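import Mathlib.NumberTheory.Padics.Complex
import Mathlib.NumberTheory.NumberField.Completion.FinitePlace
import Mathlib.Analysis.SpecificLimits.Normed
import HarnessLib

/-!
# Continuous embeddings `K_w → ℚ̄_p` on local units and principal units; ultrametric unit algebra
# (local lemmas for the avatar-on-the-ray-subgroup congruence, de Shalit 1987 II.4.13 / II.4.14 (38))

Cell `bsd-print-cf2`, width seat `bsd-line-cf2-p1-w5` g13; construction lane of the print leaf
`KatzDistributionsAtTwoPrint` (stmt-24720) of crux `PrintCf2.SplitBadTwoRankOneOfFacts` (stmt-20368).
Mathlib-only; theorems only; no `sorry`. BSD is not proved by any of this; nothing is closed by this file.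

For a number field `K`, a prime `p`, a finite place `w ∣ p` and a CONTINUOUS ring homomorphism
`emb : K_w → ℚ̄_p` (the local embeddings through which Serre's algebraic part
`Λ(x) = ∏_{(w, emb)} emb(x_w)^{-n}` of a `p`-adic avatar is written):

* `norm_map_le_one_of_norm_le_one` — a continuous ring map of normed fields sends the closed unit ball
  into the closed unit ball as soon as the source has some `π ≠ 0` with `‖π‖ < 1` (boundedness of the
  image of the unit ball by continuity at `0`, then powers);
* `norm_map_le_one_of_valued_le_one`, `norm_map_eq_one_of_valued_eq_one` — `emb(𝒪_w) ⊆ {‖·‖ ≤ 1}`,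
  `emb(𝒪_wˣ) ⊆ {‖·‖ = 1}`;
* `norm_map_sub_one_le` — **`|y − 1|_w ≤ |p^N|_w ⟹ ‖emb(y) − 1‖ ≤ p^{−N}`** (principal units of
  depth `p^N` go to principal units of depth `p^N`);
* `norm_mul_sub_one_le`, `norm_inv_sub_one_eq`, `norm_zpow_sub_one_le`, `norm_prod_sub_one_le` —
  ultrametric unit algebra (`‖ab − 1‖`, `‖a⁻¹ − 1‖`, `‖aⁿ − 1‖`, `‖∏ aᵢ − 1‖` within `r` of `1`).

Consumer: `Theorems/PrintCf2RubinValueTwoAvatarOnRaySubgroup.lean` (the arithmetic half of de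
Shalit's (38): `‖ε̂(σ) − Λ(⟨κσ⟩_v)⁻¹‖ ≤ p^{−N}` on `Gal(K̄/K(𝔪))`).

## References

* [deShalit1987] E. de Shalit, *Iwasawa theory of elliptic curves with complex multiplication* (1987),
  II.4.13 (p. 69), II.4.14 (38) (p. 72).
* [SerreAbelianLadic1968] J.-P. Serre, *Abelian ℓ-adic representations and elliptic curves* (1968),
  Ch. III §1.1 (locally algebraic characters), §2.3.
-/

noncomputable section

namespace Summit.BirchSwinnertonDyer.BirchSwinnertonDyer.Theorems.PrintCf2.AvatarOnRay

open scoped NumberField Topology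
open NumberField IsDedekindDomain IsDedekindDomain.HeightOneSpectrum

set_option linter.dupNamespace false -- D-0017: single-problem summit, `…BirchSwinnertonDyer.BirchSwinnertonDyer…` repeats a namespace by design
set_option autoImplicit false

variable {p : ℕ} [Fact p.Prime] {K : Type} [Field K] [NumberField K]


/-! ### Continuous embeddings `K_w → ℚ̄_p` on units and principal units; ultrametric unit algebra -/

section Local

open Filter

/-- **A continuous ring homomorphism of normed fields maps the closed unit ball into the closed unit
ball**, as soon as the source has an element `π ≠ 0` with `‖π‖ < 1`: by continuity at `0` the image of
the unit ball is bounded (`‖f w‖ < ‖f π‖^{-k}` once `‖π‖^k` is small), and the powers of a `y` with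
`‖y‖ ≤ 1`, `‖f y‖ > 1` would violate the bound. [folklore] -/
theorem norm_map_le_one_of_norm_le_one {F L : Type*} [NormedField F] [NormedField L] (f : F →+* L)
    (hf : Continuous f) {π : F} (hπ0 : π ≠ 0) (hπ : ‖π‖ < 1) {y : F} (hy : ‖y‖ ≤ 1) : ‖f y‖ ≤ 1 := by
  have h0 : ∀ᶠ w in 𝓝 (0 : F), ‖f w‖ < 1 := by
    have ht : Tendsto (fun w => ‖f w‖) (𝓝 0) (𝓝 0) := by
      have h := (continuous_norm.comp hf).tendsto 0
      simp only [Function.comp_def, map_zero, norm_zero] at h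
      exact h
    exact ht.eventually (gt_mem_nhds zero_lt_one)
  obtain ⟨δ, hδ, hball⟩ := Metric.eventually_nhds_iff.mp h0
  obtain ⟨k, hk⟩ := exists_pow_lt_of_lt_one hδ hπ
  have hfπ : 0 < ‖f π‖ ^ k := pow_pos (norm_pos_iff.mpr ((map_ne_zero f).mpr hπ0)) k
  have hbd : ∀ w : F, ‖w‖ ≤ 1 → ‖f π‖ ^ k * ‖f w‖ < 1 := by
    intro w hw
    have h1 : ‖f (π ^ k * w)‖ < 1 := by
      refine hball ?_
      rw [dist_zero_right, norm_mul, norm_pow]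
      calc ‖π‖ ^ k * ‖w‖ ≤ ‖π‖ ^ k * 1 := by gcongr
        _ < δ := by rw [mul_one]; exact hk
    rwa [map_mul, map_pow, norm_mul, norm_pow] at h1
  by_contra hgt
  rw [not_le] at hgt
  obtain ⟨n, hn⟩ := pow_unbounded_of_one_lt ((‖f π‖ ^ k)⁻¹) hgt
  have h := hbd (y ^ n) (by rw [norm_pow]; exact pow_le_one₀ (norm_nonneg _) hy)
  rw [map_pow, norm_pow] at h
  have h' : ‖f y‖ ^ n < (‖f π‖ ^ k)⁻¹ := by
    rw [← mul_one ((‖f π‖ ^ k)⁻¹), lt_inv_mul_iff₀ hfπ]; exact h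
  exact absurd (hn.trans h') (lt_irrefl _)

variable {w : HeightOneSpectrum (𝓞 K)}

/-- On `K_w`: `‖y‖ ≤ 1 ↔ |y|_w ≤ 1`. [folklore] -/
theorem norm_le_one_iff_valued_le_one (y : w.adicCompletion K) : ‖y‖ ≤ 1 ↔ Valued.v y ≤ 1 := by
  rw [NumberField.FinitePlace.norm_def, ← NNReal.coe_one, NNReal.coe_le_coe,
    WithZeroMulInt.toNNReal_le_one_iff (NumberField.HeightOneSpectrum.one_lt_absNorm_nnreal w)]

/-- On `K_w` the norm is monotone in the valuation. [folklore] -/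
theorem norm_le_norm_of_valued_le {y z : w.adicCompletion K} (h : Valued.v y ≤ Valued.v z) : ‖y‖ ≤ ‖z‖ := by
  rw [NumberField.FinitePlace.norm_def, NumberField.FinitePlace.norm_def, NNReal.coe_le_coe]
  exact (WithZeroMulInt.toNNReal_strictMono (NumberField.HeightOneSpectrum.one_lt_absNorm_nnreal w)).monotone h

/-- `p ∈ K_w` is nonzero of norm `< 1` at a place `w ∣ p`. [folklore] -/
theorem norm_algebraMap_natCast_lt_one (hw : ((p : ℕ) : 𝓞 K) ∈ w.asIdeal) :
    algebraMap K (w.adicCompletion K) (p : K) ≠ 0 ∧ ‖algebraMap K (w.adicCompletion K) (p : K)‖ < 1 := by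
  refine ⟨by rw [map_ne_zero]; exact_mod_cast (Fact.out : p.Prime).ne_zero, ?_⟩
  have h := (NumberField.FinitePlace.norm_lt_one_iff_mem K w ((p : ℕ) : 𝓞 K)).mpr hw
  rwa [map_natCast, map_natCast, ← map_natCast (algebraMap K (w.adicCompletion K)) p] at h

/-- **A continuous `emb : K_w → ℚ̄_p` maps `𝒪_w` into the unit ball.** [folklore] -/
theorem norm_map_le_one_of_valued_le_one (hw : ((p : ℕ) : 𝓞 K) ∈ w.asIdeal)
    (emb : w.adicCompletion K →+* PadicAlgCl p) (hemb : Continuous emb) {y : w.adicCompletion K}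
    (hy : Valued.v y ≤ 1) : ‖emb y‖ ≤ 1 :=
  norm_map_le_one_of_norm_le_one emb hemb (norm_algebraMap_natCast_lt_one hw).1
    (norm_algebraMap_natCast_lt_one hw).2 ((norm_le_one_iff_valued_le_one y).mpr hy)

/-- **… and `𝒪_wˣ` onto elements of norm `1`.** [folklore] -/
theorem norm_map_eq_one_of_valued_eq_one (hw : ((p : ℕ) : 𝓞 K) ∈ w.asIdeal)
    (emb : w.adicCompletion K →+* PadicAlgCl p) (hemb : Continuous emb) {y : w.adicCompletion K}
    (hy : Valued.v y = 1) : ‖emb y‖ = 1 := by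
  have hy0 : y ≠ 0 := by intro h; rw [h, map_zero] at hy; exact zero_ne_one hy
  refine le_antisymm (norm_map_le_one_of_valued_le_one hw emb hemb hy.le) ?_
  have h := norm_map_le_one_of_valued_le_one hw emb hemb (y := y⁻¹) (by rw [map_inv₀, hy, inv_one])
  rw [map_inv₀, norm_inv] at h
  have hpos : 0 < ‖emb y‖ := norm_pos_iff.mpr ((map_ne_zero emb).mpr hy0)
  exact (inv_le_one₀ hpos).mp h

/-- `‖p‖ = p⁻¹` in `ℚ̄_p`. [folklore] -/
theorem norm_natCast_padicAlgCl : ‖(p : PadicAlgCl p)‖ = ((p : ℝ))⁻¹ := by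
  rw [← PadicAlgCl.valuation_coe, PadicAlgCl.valuation_p]
  simp

/-- **Principal units go to principal units with the same depth**: for a continuous
`emb : K_w → ℚ̄_p` (`w ∣ p`) and `y ∈ K_w` with `|y − 1|_w ≤ |p^N|_w`, `‖emb y − 1‖ ≤ p^{−N}`.
[cite: deShalit1987, II.4.13 (p. 69)] -/
theorem norm_map_sub_one_le (hw : ((p : ℕ) : 𝓞 K) ∈ w.asIdeal)
    (emb : w.adicCompletion K →+* PadicAlgCl p) (hemb : Continuous emb) {N : ℕ} {y : w.adicCompletion K}
    (hy : Valued.v (y - 1) ≤ Valued.v (algebraMap K (w.adicCompletion K) ((p : K) ^ N))) :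
    ‖emb y - 1‖ ≤ ((p : ℝ)⁻¹) ^ N := by
  set q : w.adicCompletion K := algebraMap K (w.adicCompletion K) ((p : K) ^ N) with hq
  have hq0 : q ≠ 0 := by
    rw [hq, map_pow]; exact pow_ne_zero _ (norm_algebraMap_natCast_lt_one hw).1
  have hu : Valued.v ((y - 1) / q) ≤ 1 := by
    rw [map_div₀]
    exact div_le_one_of_le₀ hy zero_le
  have hsplit : emb y - 1 = emb q * emb ((y - 1) / q) := by
    rw [← map_mul, mul_div_cancel₀ _ hq0, map_sub, map_one]
  have hembq : emb q = (p : PadicAlgCl p) ^ N := by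
    rw [hq, map_pow, map_pow, map_natCast, map_natCast]
  rw [hsplit, norm_mul, hembq, norm_pow, norm_natCast_padicAlgCl]
  calc ((p : ℝ))⁻¹ ^ N * ‖emb ((y - 1) / q)‖ ≤ ((p : ℝ))⁻¹ ^ N * 1 := by
        gcongr; exact norm_map_le_one_of_valued_le_one hw emb hemb hu
    _ = ((p : ℝ))⁻¹ ^ N := mul_one _

variable {L : Type*} [NormedField L] [IsUltrametricDist L]

omit [Fact p.Prime] in
/-- Ultrametric unit algebra: `‖ab − 1‖ ≤ max ‖a − 1‖ ‖b − 1‖` for `‖a‖ ≤ 1`. [folklore] -/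
theorem norm_mul_sub_one_le {a b : L} {r : ℝ} (ha : ‖a‖ ≤ 1) (ha1 : ‖a - 1‖ ≤ r) (hb1 : ‖b - 1‖ ≤ r) :
    ‖a * b - 1‖ ≤ r := by
  have h : a * b - 1 = a * (b - 1) + (a - 1) := by ring
  rw [h]
  refine (IsUltrametricDist.norm_add_le_max _ _).trans (max_le ?_ ha1)
  rw [norm_mul]
  calc ‖a‖ * ‖b - 1‖ ≤ 1 * ‖b - 1‖ := by gcongr
    _ ≤ r := by rw [one_mul]; exact hb1

omit [Fact p.Prime] [IsUltrametricDist L] in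
/-- `‖a⁻¹ − 1‖ = ‖a − 1‖` for `‖a‖ = 1`. [folklore] -/
theorem norm_inv_sub_one_eq {a : L} (ha : ‖a‖ = 1) : ‖a⁻¹ - 1‖ = ‖a - 1‖ := by
  have ha0 : a ≠ 0 := by intro h; rw [h, norm_zero] at ha; exact zero_ne_one ha
  have h : a⁻¹ - 1 = a⁻¹ * (1 - a) := by rw [mul_sub, mul_one, inv_mul_cancel₀ ha0]
  rw [h, norm_mul, norm_inv, ha, inv_one, one_mul, norm_sub_rev]

omit [Fact p.Prime] in
/-- `‖a^n − 1‖ ≤ ‖a − 1‖` for `‖a‖ = 1`, `n ∈ ℤ`. [folklore] -/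
theorem norm_zpow_sub_one_le {a : L} (ha : ‖a‖ = 1) {r : ℝ} (h : ‖a - 1‖ ≤ r) (n : ℤ) :
    ‖a ^ n - 1‖ ≤ r := by
  have hr : 0 ≤ r := (norm_nonneg _).trans h
  have hnat : ∀ k : ℕ, ‖a ^ k - 1‖ ≤ r := by
    intro k
    induction k with
    | zero => rw [pow_zero, sub_self, norm_zero]; exact hr
    | succ k ih => rw [pow_succ]; exact norm_mul_sub_one_le (by rw [norm_pow, ha, one_pow]) ih h
  cases n with
  | ofNat k => rw [Int.ofNat_eq_natCast, zpow_natCast]; exact hnat k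
  | negSucc k =>
    rw [zpow_negSucc, norm_inv_sub_one_eq (by rw [norm_pow, ha, one_pow])]
    exact hnat (k + 1)

omit [Fact p.Prime] in
/-- A finite product of elements of norm `≤ 1`, each within `r` of `1`, is within `r` of `1` (`0 ≤ r`).
[folklore] -/
theorem norm_prod_sub_one_le {ι' : Type*} (s : Finset ι') (f : ι' → L) {r : ℝ} (hr : 0 ≤ r)
    (hf : ∀ i ∈ s, ‖f i‖ ≤ 1) (hf1 : ∀ i ∈ s, ‖f i - 1‖ ≤ r) : ‖∏ i ∈ s, f i - 1‖ ≤ r := by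
  classical
  induction s using Finset.induction_on with
  | empty => rw [Finset.prod_empty, sub_self, norm_zero]; exact hr
  | insert i s hi ih =>
    rw [Finset.prod_insert hi]
    have hs : ‖∏ j ∈ s, f j‖ ≤ 1 := by
      rw [norm_prod]  -- NormedField: norm_prod
      exact Finset.prod_le_one (fun j _ => norm_nonneg _) fun j hj => hf j (Finset.mem_insert_of_mem hj)
    rw [mul_comm]
    exact norm_mul_sub_one_le hs (ih (fun j hj => hf j (Finset.mem_insert_of_mem hj))
      (fun j hj => hf1 j (Finset.mem_insert_of_mem hj))) (hf1 i (Finset.mem_insert_self i s))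

end Local

end Summit.BirchSwinnertonDyer.BirchSwinnertonDyer.Theorems.PrintCf2.AvatarOnRay

end
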